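import Literature.MathematicalPhysics.QuantumFieldTheory.King1986.CompositionRate
import HarnessLib

/-!
# King 1986 §4: the TWO-SPACING SYMBOL of the flat scalar free propagator is bounded by `C·η²`
# — (4.7) for `Δ^η` and Lemma 4.2 for the composed operator (4.12), combined (ℓ²-currency, no logarithm)

**Citation header (reproduction of PUBLISHED work; literature seat `b2b-balaban-t4-lit2` gen 4 of the Bałaban
lattice Yang–Mills cell `pub-balaban`; record `t4/T4-LIT2-CITABLE-NE.md` v2.6 §8.9; a 2-line corollary of the tree's
`King1986/EffectiveLaplacianRate` and `King1986/CompositionRate`, filed separately so that consumers can cite ONE name).**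
C. King, *The U(1) Higgs model. I. The continuum limit*, Commun. Math. Phys. **102** (1986) 649–677 [King1986], §4
pp. 670–673.  Page images read (as images) by this seat: `b2b-balaban-template/king-renders/1986-cmp102-king-u1-higgs-I-p022-x2.png`
(p. 670: (4.1)–(4.6)), `…-p023-x2.png` (p. 671: (4.7)–(4.16), Lemmas 4.1–4.2), `…-p024-x2.png` (p. 672: (4.17)–(4.23),
Lemma 4.3), `…-p025-x2.png` (p. 673: (4.24)–(4.31), Lemma 4.4).

**What King prints (verbatim).**  p. 670: «Δ^η(p) = 4η^{−2} Σ_{μ=1}^d sin²(½ηp_μ) + m²(L^kε)², (4.4)»; p. 671: «where the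
operator D satisfies (i) |D^{−1}(p) − (|p|² + m²(L^kε)²)^{−1}| ≤ CL^{−2k}, (4.7) (ii) 0 ≤ C|p|² ≤ D(p). (4.8)» … «Proof. We
first check that Δ^η(p) satisfies (4.7) and (4.8). By using x² ≥ sin²x ≥ x² − x⁴/3, we have
|Δ^η(p) − (|p|² + m²(L^kε)²)| ≤ Cη² Σ_{μ=1}^d |p_μ|⁴ ≤ CL^{−2k}|p|⁴, (4.10) from which (4.7) follows.» … «the composition
law for renormalization transformations allows us to write Δ^{(k+n)}(p′) in the form (4.6), with
D^{−1}(p) = a_n^{−1}L^{−2k} + Σ_{l′} |u_n^{η′}(p + l′)|²Δ^{η′}(p + l′)^{−1}, (4.12)» … «**Lemma 4.2.** The operator (4.12)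
satisfies (4.7) and (4.8).» (proof (4.14)–(4.17)); p. 673: «Finally, from (4.7)
|Δ^{η′}(p′ + l)^{−1} − Δ^η(p′ + l)^{−1}| ≤ CL^{−2k} ≤ CL^{−γk}|p′ + l|^{−2+γ}. (4.31)» — the SHARP second-order rate
`L^{−2k} = η²` at SYMBOL level, which King then deliberately weakens to `L^{−γk}` («γ sufficiently small», Props. 3.8/3.9)
because (p. 672–673) «We must always be careful to keep enough negative powers of momentum so that the sum over l is
bounded.»

**What is proved here (everything PROVED, Mathlib + the two tree modules; NO named fact, nothing about Bałaban's
papers).**  In the rescaled variable `y = ηp ∈ [−π, π]^d` of `CompositionRate` (coarse spacing `1`, fine spacing `1/R`,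
`R = L^n ≥ 1` the refinement factor, rescaled mass `M̃ ≥ 0`):
* `twoSpacingSymbol R M̃ y := Δ¹_{M̃}(y)⁻¹ − Σ_{m ∈ (Fin R)^d} Ur R m y · (DeltaXir R M̃ (y + 2πm))⁻¹`
  (= `(latticeSymbol 1 M̃ y)⁻¹ − composedInvResc 0 R M̃ y`: the coarse free resolvent symbol MINUS King's composed
  symbol (4.12) WITHOUT its constant `a_n⁻¹L^{−2k}`, i.e. the pure alias sum `Σ_{l′}|u_n^{η′}(p+l′)|²Δ^{η′}(p+l′)⁻¹`);
* **`abs_twoSpacingSymbol_le`**: `|twoSpacingSymbol R M̃ y| ≤ π²/24 + 1/3` for every `y ≠ 0` of the zone `|y_μ| ≤ π`,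
  UNIFORMLY in `R ≥ 1`, `M̃ ≥ 0` and the dimension — (4.7) for `Δ^η` (`latticeSymbol_inv_sub_ref_le`, constant `π²/48`)
  plus Lemma 4.2 (`lemma42_resc` with `c = 0`, constant `π²/48 + 1/3`) by the triangle inequality;
* **`abs_twoSpacing_unscaled_le`**: King's units (`η = N⁻¹`, `η′ = (NR)⁻¹`, mass `M ≥ 0`, alias point `q ≠ 0` with
  `|q_μ| ≤ πN`): `|Δ^η_M(q)⁻¹ − composedInv 0 N R M q| ≤ (π²/24 + 1/3)·N⁻²` — «≤ CL^{−2k}» with `C = π²/24 + 1/3 < 3/4`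
  (`twoSpacing_const_lt`).
READING (dictionary, [analysis] — NOT a typed operator identity here): by the aliasing representation of the flat
`L^n`-block mean with Fourier weight `u` ((4.2)–(4.3), (4.12)–(4.13); the tree's `B4Strip.Ur`, `AliasingIdentity.sum_Ur_eq_one`),
`composedInvResc 0 R M̃` is the Fourier symbol of `Q_n(−Δ^{η′} + m²)⁻¹Q_n^*` transported to the `η`-lattice, so the two
theorems say: the translation-invariant TWO-SPACING DIFFERENCE `E = (−Δ^η + m²)⁻¹ − Q_n(−Δ^{η′} + m²)⁻¹Q_n^*` of the FLAT
SCALAR FREE propagators has a symbol bounded by `C·η²` on the whole Brillouin zone minus `{0}` (massless case `m = 0`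
included: the zero mode is the one excluded point), hence — by Parseval on any torus whose nonzero momenta lie in the
zone — an `ℓ² → ℓ²` operator norm `≤ C·η²` in King's units (`≤ C` in `η`-lattice units), with NO logarithm in the number
of scales and NO Hölder loss.  What this does NOT give: any POINTWISE kernel bound (King's pointwise two-spacing statements
are Props. 3.8/3.9 (3.71)–(3.75) pp. 664–665 with the weakened rate `L^{−γk}`), any `ℓ^∞ → ℓ^∞` bound, anything for
covariant (background-dependent) averaging of 1-forms or for Bałaban's Landau-gauge objects.  Cell use: record
`t4/T4-LIT2-CITABLE-NE.md` §8.9 (the printed ℓ²-currency relative of the T⁴ cell's unprinted two-spacing kernel bound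
`T4TwoSpacingDefect.TwoSpacingSized`, GAPS G-ne3p1-13, G-ne3p1-14).  Rung (B)+1 literature service; NOT summit progress.
-/

noncomputable section

open Finset Real
open Literature.MathematicalPhysics.QuantumFieldTheory.Balaban1983to89

namespace Literature.MathematicalPhysics.QuantumFieldTheory.King1986

variable {dd : ℕ}

/-- The rescaled TWO-SPACING SYMBOL of the flat scalar free propagator: coarse resolvent symbol (spacing `1`, mass `M̃`)
minus the block-averaged fine one (spacing `1/R`), `Δ¹_{M̃}(y)⁻¹ − Σ_m Ur R m y · DeltaXir R M̃ (y + 2πm)⁻¹`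
= `(latticeSymbol 1 M̃ y)⁻¹ − composedInvResc 0 R M̃ y`. [cite: King1986, (4.4) p.670, (4.12)–(4.13) p.671] -/
def twoSpacingSymbol (R : ℕ) (Mt : ℝ) (y : Fin dd → ℝ) : ℝ :=
  (latticeSymbol 1 Mt y)⁻¹ - composedInvResc 0 R Mt y

/-- Unfolding: the two-spacing symbol is the coarse inverse symbol minus the pure alias sum of (4.12). [folklore] -/
theorem twoSpacingSymbol_eq (R : ℕ) (Mt : ℝ) (y : Fin dd → ℝ) :
    twoSpacingSymbol R Mt y = (latticeSymbol 1 Mt y)⁻¹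
      - ∑ m : Fin dd → Fin R, B4Strip.Ur R m y * (B4Strip.DeltaXir R Mt (B4Strip.shiftr R m y))⁻¹ := by
  unfold twoSpacingSymbol composedInvResc
  ring

/-- **The two-spacing symbol is bounded, uniformly in the refinement factor, the mass and the dimension**:
`|twoSpacingSymbol R M̃ y| ≤ π²/24 + 1/3` on the Brillouin zone `|y_μ| ≤ π`, `y ≠ 0`, for `R ≥ 1`, `M̃ ≥ 0`.
King's (4.7) for `Δ^η` ((4.10)) and Lemma 4.2 ((4.7) for the composed operator (4.12)), combined by the triangle
inequality; constants from `latticeSymbol_inv_sub_ref_le` (`π²/48`) and `lemma42_resc` (`π²/48 + 1/3` at `c = 0`).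
[cite: King1986, (4.7)/(4.10) p.671; Lemma 4.2 with (4.14)–(4.16) p.671; (4.31) p.673] -/
theorem abs_twoSpacingSymbol_le {R : ℕ} [NeZero R] (hR : 1 ≤ R) {Mt : ℝ} (hMt : 0 ≤ Mt)
    {y : Fin dd → ℝ} (hy : ∀ μ, |y μ| ≤ π) (hy0 : 0 < momSq y) :
    |twoSpacingSymbol R Mt y| ≤ π ^ 2 / 24 + 1 / 3 := by
  have hy1 : ∀ μ, |(1 : ℝ) * y μ| ≤ π := fun μ => by simpa using hy μ
  have h1 : |(latticeSymbol 1 Mt y)⁻¹ - (momSq y + Mt)⁻¹| ≤ π ^ 2 / 48 * (1 : ℝ) ^ 2 :=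
    latticeSymbol_inv_sub_ref_le one_ne_zero hMt hy1 hy0
  have h2 : |composedInvResc 0 R Mt y - (momSq y + Mt)⁻¹| ≤ 0 + π ^ 2 / 48 + 1 / 3 :=
    lemma42_resc le_rfl hR hMt hy hy0
  have hsplit : twoSpacingSymbol R Mt y
      = ((latticeSymbol 1 Mt y)⁻¹ - (momSq y + Mt)⁻¹) - (composedInvResc 0 R Mt y - (momSq y + Mt)⁻¹) := by
    unfold twoSpacingSymbol; ring
  rw [hsplit]
  calc |((latticeSymbol 1 Mt y)⁻¹ - (momSq y + Mt)⁻¹) - (composedInvResc 0 R Mt y - (momSq y + Mt)⁻¹)|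
      ≤ |(latticeSymbol 1 Mt y)⁻¹ - (momSq y + Mt)⁻¹| + |composedInvResc 0 R Mt y - (momSq y + Mt)⁻¹| :=
        abs_sub _ _
    _ ≤ π ^ 2 / 48 * (1 : ℝ) ^ 2 + (0 + π ^ 2 / 48 + 1 / 3) := add_le_add h1 h2
    _ = π ^ 2 / 24 + 1 / 3 := by ring

/-- **King's units** (`η = N⁻¹` coarse, `η′ = (NR)⁻¹` fine, `N = L^k ≥ 1`, `R = L^n ≥ 1`, mass `M ≥ 0`): at every
alias point `q ≠ 0` of the `η`-zone `|q_μ| ≤ πN`,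
`|Δ^η_M(q)⁻¹ − composedInv 0 N R M q| ≤ (π²/24 + 1/3)·N⁻²` — «≤ CL^{−2k}», the sharp second-order two-spacing rate
at symbol level ((4.31), first inequality).  [cite: King1986, (4.7) p.671, Lemma 4.2 p.671, (4.31) p.673] -/
theorem abs_twoSpacing_unscaled_le {N R : ℕ} (hN : 1 ≤ N) [NeZero R] (hR : 1 ≤ R) {M : ℝ} (hM : 0 ≤ M)
    {q : Fin dd → ℝ} (hq : ∀ μ, |q μ| ≤ π * N) (hq0 : 0 < momSq q) :
    |(latticeSymbol ((N : ℝ)⁻¹) M q)⁻¹ - composedInv 0 N R M q|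
      ≤ (π ^ 2 / 24 + 1 / 3) * ((N : ℝ) ^ 2)⁻¹ := by
  have hN0 : N ≠ 0 := by omega
  have hN' : (0 : ℝ) < N := by exact_mod_cast (Nat.pos_of_ne_zero hN0)
  have hNinv : ((N : ℝ)⁻¹) ≠ 0 := inv_ne_zero (ne_of_gt hN')
  have hqz : ∀ μ, |(N : ℝ)⁻¹ * q μ| ≤ π := by
    intro μ
    rw [abs_mul, abs_inv, Nat.abs_cast]
    rw [inv_mul_le_iff₀ hN']
    calc |q μ| ≤ π * N := hq μ
      _ = (N : ℝ) * π := by ring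
  have h1 : |(latticeSymbol ((N : ℝ)⁻¹) M q)⁻¹ - (momSq q + M)⁻¹| ≤ π ^ 2 / 48 * ((N : ℝ)⁻¹) ^ 2 :=
    latticeSymbol_inv_sub_ref_le hNinv hM hqz hq0
  have h2 : |composedInv 0 N R M q - (momSq q + M)⁻¹| ≤ (0 + π ^ 2 / 48 + 1 / 3) * ((N : ℝ) ^ 2)⁻¹ :=
    lemma42 le_rfl hN hR hM hq hq0
  have hsplit : (latticeSymbol ((N : ℝ)⁻¹) M q)⁻¹ - composedInv 0 N R M q
      = ((latticeSymbol ((N : ℝ)⁻¹) M q)⁻¹ - (momSq q + M)⁻¹) - (composedInv 0 N R M q - (momSq q + M)⁻¹) := by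
    ring
  rw [hsplit]
  have hinv : ((N : ℝ)⁻¹) ^ 2 = ((N : ℝ) ^ 2)⁻¹ := by rw [inv_pow]
  calc |((latticeSymbol ((N : ℝ)⁻¹) M q)⁻¹ - (momSq q + M)⁻¹) - (composedInv 0 N R M q - (momSq q + M)⁻¹)|
      ≤ |(latticeSymbol ((N : ℝ)⁻¹) M q)⁻¹ - (momSq q + M)⁻¹| + |composedInv 0 N R M q - (momSq q + M)⁻¹| :=
        abs_sub _ _
    _ ≤ π ^ 2 / 48 * ((N : ℝ)⁻¹) ^ 2 + (0 + π ^ 2 / 48 + 1 / 3) * ((N : ℝ) ^ 2)⁻¹ := add_le_add h1 h2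
    _ = (π ^ 2 / 24 + 1 / 3) * ((N : ℝ) ^ 2)⁻¹ := by rw [hinv]; ring

/-- The constant is numerically `< 3/4` (`π² < 10`). [folklore] -/
theorem twoSpacing_const_lt : π ^ 2 / 24 + 1 / 3 < (3 : ℝ) / 4 := by
  have h := Real.pi_lt_d2
  have h0 := Real.pi_pos
  nlinarith

end Literature.MathematicalPhysics.QuantumFieldTheory.King1986

end
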